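import Mathlib
import Literature.Analysis.ODE.RegularSingularAnalyticBranchSolution
import HarnessLib

/-!
# The logarithmic (resonant) Frobenius branch at a regular singular point:
# `Y_L(x) = κ log(x) • Y_s(x) + W(x)` for `x v′ = M(x) v`

Topic `Literature/Analysis/ODE` (namespace `Literature.Analysis.ODE`). Continuation of
`RegularSingularAnalyticBranch.lean` / `RegularSingularAnalyticBranchSolution.lean` (the ANALYTIC branch
`v = Σ xⁿ • vₙ` of `x v′ = M(x) v + g(x)` under the quantitative non-resonance data `IsFrobeniusData M g R v₀ a K G c`).
Those files leave out «the second (singular / logarithmic) Frobenius branch; resonant cases». This file supplies the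
LOGARITHMIC second branch in the form that covers the resonant scalar equations of mathematical physics (indicial
exponents differing by an integer, e.g. the marginal tearing-mode / cylindrical Newcomb equation at a rational
surface, exponents `{0, 1}`), WITHOUT any new series estimate: if `Y_s = Σ xⁿ • sₙ` is the analytic branch of the
HOMOGENEOUS system through `s₀` and `ℓ` is a branch of the logarithm (`x ℓ′(x) = 1`), then

  `Y_L(x) = κ ℓ(x) • Y_s(x) + W(x)`  solves  `x Y_L′ = M(x) Y_L`  iff  `x W′ = M(x) W − κ Y_s(x)`,

an INHOMOGENEOUS system with analytic right-hand side `g = −κ s` — exactly the shape the analytic-branch theorem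
already treats. Its order-`0` compatibility `M₀ w₀ = κ s₀` is the resonance condition: it is what fixes the
logarithmic coefficient `κ` (in the scalar case `κ = −q₀ η₀`, see `RegularSingularLogBranchScalar.lean`).

* `hasDerivAt_logComb` — the pointwise calculus identity behind the display above (any `𝓜 ∈ L(E)`, any `ℓ` with
  `ℓ′(x) = x⁻¹`, `x ≠ 0`);
* `logBranchInhom M R s₀ κ` — the inhomogeneity `gₖ = −κ • sₖ`; `IsFrobeniusData.logBranch` — THE REDUCTION: from
  `IsFrobeniusData M 0 R s₀ a K 0 c` and `M₀ w₀ = κ s₀`, the regular part has `IsFrobeniusData` with rate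
  `λ = a(1 + 2cK)` and `G = ‖κ‖‖s₀‖` (so all the conclusions of `IsFrobeniusData.analyticBranch` — convergence,
  majorants `‖wₖ‖ ≤ max ‖w₀‖ (2c‖κ‖‖s₀‖) λ'ᵏ`, `λ' = λ(1 + 2cK)`, analyticity, uniqueness — apply to `W`);
* `frobeniusLogSol M R s₀ κ w₀ ℓ` — THE LOGARITHMIC BRANCH, and `IsFrobeniusData.frobeniusLogSol_ode` — it is
  differentiable and solves `x • Y_L′(x) = (Σ xᵏ • Mₖ) Y_L(x)` at every `x ≠ 0` with `λ'‖x‖ < 1` where the supplied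
  `ℓ` has `ℓ′(x) = x⁻¹` (over `ℝ`: `Real.log = log|·|` on both half-lines; over `ℂ`: `Complex.log` off the cut, or
  `z ↦ log(−z)`).

Everything is over `𝕜 = ℝ` or `ℂ` (`RCLike 𝕜`) and a Banach space `E`, with explicit constants, as in parts I–II.
NOT here: exponent differences `N ≥ 2` reached by a jet shift, higher nilpotency (`log²` terms), uniqueness among
non-analytic solutions.

## References
* E. A. Coddington, N. Levinson, *Theory of Ordinary Differential Equations*, McGraw–Hill 1955, Ch. 4 §8
  (second-order equations with a regular singular point: the logarithmic case). Key `CoddingtonLevinson1955`.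
* P. Hartman, *Ordinary Differential Equations*, SIAM Classics 38 (2002), Ch. IV §§11–12. Key `Hartman2002`.
-/

noncomputable section

open Finset Filter Metric
open scoped Topology NNReal ENNReal

namespace Literature.Analysis.ODE

variable {𝕜 : Type*} [RCLike 𝕜] {E : Type*} [NormedAddCommGroup E] [NormedSpace 𝕜 E]

/-! ### Pointwise calculus of the logarithmic combination `κ ℓ(x) • Y_s(x) + W(x)` -/

/-- **LOG-COMBINATION RULE** (pointwise). Let `𝓜 ∈ L(E)`, `x ≠ 0`, and let `ℓ` be differentiable at `x` with
`ℓ′(x) = x⁻¹` (any local branch of the logarithm: `log x`, `log(−x)`, `log|x|` on a real half-line, …). If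
`x • Y_s′ = 𝓜 Y_s(x)` and `x • W′ = 𝓜 W(x) − κ • Y_s(x)` at `x`, then `Y_L = κ ℓ • Y_s + W` is differentiable at
`x` with `x • Y_L′ = 𝓜 Y_L(x)`: the inhomogeneity `−κ Y_s` of the regular part is exactly what the derivative of
the logarithm produces. [cite: CoddingtonLevinson1955, Ch. 4 §8] -/
theorem hasDerivAt_logComb {Ys W : 𝕜 → E} {Ys' W' : E} {ℓ : 𝕜 → 𝕜} {κ x : 𝕜} (𝓜 : E →L[𝕜] E)
    (hx : x ≠ 0) (hℓ : HasDerivAt ℓ x⁻¹ x) (hYs : HasDerivAt Ys Ys' x) (hW : HasDerivAt W W' x)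
    (hYs_eq : x • Ys' = 𝓜 (Ys x)) (hW_eq : x • W' = 𝓜 (W x) - κ • Ys x) :
    HasDerivAt (fun z => κ • ℓ z • Ys z + W z) (κ • (ℓ x • Ys' + x⁻¹ • Ys x) + W') x ∧
      x • (κ • (ℓ x • Ys' + x⁻¹ • Ys x) + W') = 𝓜 (κ • ℓ x • Ys x + W x) := by
  refine ⟨((hℓ.smul hYs).const_smul κ).add hW, ?_⟩
  rw [smul_add, hW_eq, smul_comm x κ, smul_add, smul_comm x (ℓ x), hYs_eq, smul_smul x x⁻¹,
    mul_inv_cancel₀ hx, one_smul, map_add, map_smul, map_smul, smul_add]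
  abel

/-! ### The regular part `W` as an analytic branch: Frobenius data with inhomogeneity `−κ Y_s` -/

section LogBranch

variable {M : ℕ → E →L[𝕜] E} {R : ℕ → E →L[𝕜] E} {s₀ : E} {a K c : ℝ}

/-- The inhomogeneity of the regular part of the logarithmic branch: `gₖ = −κ • sₖ`, where `sₖ` are the
Frobenius coefficients of the analytic (small) solution `Y_s = Σ xᵏ • sₖ` of the homogeneous system.
[cite: CoddingtonLevinson1955, Ch. 4 §8] -/
def logBranchInhom (M : ℕ → E →L[𝕜] E) (R : ℕ → E →L[𝕜] E) (s₀ : E) (κ : 𝕜) (k : ℕ) : E :=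
  -(κ • frobeniusCoeff M (fun _ => 0) R s₀ k)

/-- `g₀ = −κ • s₀`: the order-`0` inhomogeneity is `−κ` times the leading coefficient of the small solution.
[cite: CoddingtonLevinson1955, Ch. 4 §8] -/
@[simp] theorem logBranchInhom_zero (M : ℕ → E →L[𝕜] E) (R : ℕ → E →L[𝕜] E) (s₀ : E) (κ : 𝕜) :
    logBranchInhom M R s₀ κ 0 = -(κ • s₀) := by
  rw [logBranchInhom, frobeniusCoeff_zero]

/-- **FROBENIUS DATA OF THE REGULAR PART.** If the homogeneous system `x v′ = M(x) v` has Frobenius data through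
`s₀` (`IsFrobeniusData M 0 R s₀ a K 0 c`, small solution `Y_s`), and `w₀`, `κ` satisfy the RESONANT
COMPATIBILITY `M₀ w₀ = κ s₀` (a linear condition tying the logarithmic coefficient `κ` to `w₀`; in the scalar case with
exponents `{0, 1}` it reads `κ = −q₀ η₀`), then the
inhomogeneous system `x W′ = M(x) W − κ Y_s(x)` has Frobenius data through `w₀` with decay rate
`λ = a(1 + 2cK)` (the rate of the coefficients of `Y_s`) and `G = ‖κ‖ ‖s₀‖`. [cite: CoddingtonLevinson1955, Ch. 4 §8] -/
theorem IsFrobeniusData.logBranch (h : IsFrobeniusData M (fun _ => 0) R s₀ a K 0 c) {κ : 𝕜} {w₀ : E}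
    (hw : M 0 w₀ = κ • s₀) :
    IsFrobeniusData M (logBranchInhom M R s₀ κ) R w₀ (a * (1 + 2 * c * K)) K (‖κ‖ * ‖s₀‖) c where
  a_nonneg := h.a_le_lam.1
  K_nonneg := h.K_nonneg
  G_nonneg := by positivity
  c_nonneg := h.c_nonneg
  norm_M_le k hk := (h.norm_M_le k hk).trans
    (mul_le_mul_of_nonneg_left (pow_le_pow_left₀ h.a_nonneg h.a_le_lam.2 k) h.K_nonneg)
  norm_g_le k _ := by
    have hk := h.norm_coeff_le k
    rw [mul_zero, max_eq_left (norm_nonneg _)] at hk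
    rw [logBranchInhom, norm_neg, norm_smul, mul_assoc]
    exact mul_le_mul_of_nonneg_left hk (norm_nonneg _)
  rightInverse := h.rightInverse
  norm_R_le := h.norm_R_le
  compat := by rw [logBranchInhom_zero, hw, add_neg_cancel]

/-- **The logarithmic Frobenius branch** `Y_L(x) = κ ℓ(x) • Y_s(x) + W(x)`: `Y_s = frobeniusSol M 0 R s₀` the analytic
branch through `s₀`, `W = frobeniusSol M (−κ s) R w₀` its regular part, `ℓ` a supplied branch of the logarithm.
[cite: CoddingtonLevinson1955, Ch. 4 §8] -/
def frobeniusLogSol (M : ℕ → E →L[𝕜] E) (R : ℕ → E →L[𝕜] E) (s₀ : E) (κ : 𝕜) (w₀ : E) (ℓ : 𝕜 → 𝕜)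
    (x : 𝕜) : E :=
  κ • ℓ x • frobeniusSol M (fun _ => 0) R s₀ x + frobeniusSol M (logBranchInhom M R s₀ κ) R w₀ x

/-- The inhomogeneity series sums to `−κ • Y_s(x)` inside the disc of `Y_s`: the right-hand side of the equation
for the regular part is `−κ Y_s`. [cite: CoddingtonLevinson1955, Ch. 4 §8] -/
theorem IsFrobeniusData.hasSum_logBranchInhom [CompleteSpace E] (h : IsFrobeniusData M (fun _ => 0) R s₀ a K 0 c)
    (κ : 𝕜) {x : 𝕜} (hx : a * (1 + 2 * c * K) * ‖x‖ < 1) :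
    HasSum (fun k => x ^ k • logBranchInhom M R s₀ κ k) (-(κ • frobeniusSol M (fun _ => 0) R s₀ x)) := by
  have hS := ((h.hasSum_frobeniusSol hx).const_smul κ).neg
  convert hS using 1
  funext k
  rw [logBranchInhom, smul_neg, smul_comm]

/-- **THE LOGARITHMIC BRANCH SOLVES THE EQUATION.** Under `IsFrobeniusData M 0 R s₀ a K 0 c` and the resonant
compatibility `M₀ w₀ = κ s₀`, put `λ := a(1 + 2cK)` and `λ' := λ(1 + 2cK)`. For every `x` with `λ'‖x‖ < 1`,
`x ≠ 0`, and every `ℓ` with `ℓ′(x) = x⁻¹`, the logarithmic branch `Y_L = κ ℓ • Y_s + W` is differentiable at `x` and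
solves `x • Y_L′(x) = (Σ xᵏ • Mₖ) Y_L(x)`. Both `Y_s` and `W` are analytic on `λ'‖x‖ < 1` with the explicit
coefficient majorants of `IsFrobeniusData.analyticBranch` (`‖sₖ‖ ≤ ‖s₀‖ λᵏ`, `‖wₖ‖ ≤ max ‖w₀‖ (2c‖κ‖‖s₀‖) λ'ᵏ`).
[cite: CoddingtonLevinson1955, Ch. 4 §8] -/
theorem IsFrobeniusData.frobeniusLogSol_ode [CompleteSpace E] (h : IsFrobeniusData M (fun _ => 0) R s₀ a K 0 c)
    {κ : 𝕜} {w₀ : E} (hw : M 0 w₀ = κ • s₀) {ℓ : 𝕜 → 𝕜} {x : 𝕜}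
    (hx : a * (1 + 2 * c * K) * (1 + 2 * c * K) * ‖x‖ < 1) (hx0 : x ≠ 0) (hℓ : HasDerivAt ℓ x⁻¹ x) :
    DifferentiableAt 𝕜 (frobeniusLogSol M R s₀ κ w₀ ℓ) x ∧
      x • deriv (frobeniusLogSol M R s₀ κ w₀ ℓ) x = (∑' k, x ^ k • M k) (frobeniusLogSol M R s₀ κ w₀ ℓ x) := by
  have hW := h.logBranch hw
  have h1 : (1 : ℝ) ≤ 1 + 2 * c * K := by nlinarith [h.c_nonneg, h.K_nonneg, mul_nonneg h.c_nonneg h.K_nonneg]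
  have hxl : a * (1 + 2 * c * K) * ‖x‖ < 1 := by
    refine lt_of_le_of_lt ?_ hx
    have h0 : 0 ≤ a * (1 + 2 * c * K) * ‖x‖ := mul_nonneg h.a_le_lam.1 (norm_nonneg _)
    calc a * (1 + 2 * c * K) * ‖x‖ = a * (1 + 2 * c * K) * ‖x‖ * 1 := (mul_one _).symm
      _ ≤ a * (1 + 2 * c * K) * ‖x‖ * (1 + 2 * c * K) := mul_le_mul_of_nonneg_left h1 h0
      _ = a * (1 + 2 * c * K) * (1 + 2 * c * K) * ‖x‖ := by ring
  -- the two analytic pieces and their equations at `x`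
  obtain ⟨-, -, hYs⟩ := (h.analyticBranch).2.2.1 x hxl
  obtain ⟨-, -, hWs⟩ := (hW.analyticBranch).2.2.1 x hx
  have hYs_d := (h.hasDerivAt_frobeniusSol hxl)
  have hW_d := (hW.hasDerivAt_frobeniusSol hx)
  have hYs_eq : x • deriv (frobeniusSol M (fun _ => 0) R s₀) x =
      (∑' k, x ^ k • M k) (frobeniusSol M (fun _ => 0) R s₀ x) := by
    rw [hYs.1, tsum_congr (fun k => smul_zero (x ^ k)), tsum_zero, add_zero]
  have hW_eq : x • deriv (frobeniusSol M (logBranchInhom M R s₀ κ) R w₀) x =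
      (∑' k, x ^ k • M k) (frobeniusSol M (logBranchInhom M R s₀ κ) R w₀ x)
        - κ • frobeniusSol M (fun _ => 0) R s₀ x := by
    rw [hWs.1, (h.hasSum_logBranchInhom κ hxl).tsum_eq, sub_eq_add_neg]
  have key := hasDerivAt_logComb (∑' k, x ^ k • M k) hx0 hℓ hYs_d.differentiableAt.hasDerivAt
    hW_d.differentiableAt.hasDerivAt hYs_eq hW_eq
  refine ⟨key.1.differentiableAt, ?_⟩
  rw [show frobeniusLogSol M R s₀ κ w₀ ℓ = fun z => κ • ℓ z • frobeniusSol M (fun _ => 0) R s₀ z +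
      frobeniusSol M (logBranchInhom M R s₀ κ) R w₀ z from rfl, key.1.deriv]
  exact key.2

end LogBranch

end Literature.Analysis.ODE

end
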